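import Summits.QuantumFields.YangMills.Theses.ParabolicTrajectory
import Literature.Probability.LatticeModels.GibbsSpecification
import Literature.MathematicalPhysics.QuantumFieldTheory.YangMillsOS
import Mathlib.Probability.Moments.Covariance

/-!
# Line `orbit-kantorovich-finite-size` — skeleton for crux `ParabolicTrajectory.LatticeGapOnTrajectory`
(stmt-QuantumFields-10523, conjunct (B) of route ParabolicTrajectory rev 4), crux-plan round 1.

**Idea (Cruxes/LatticeGapOnTrajectory/Ideas/orbit-kantorovich-finite-size.md; triage r1-1/2/3: pass).**
Weak coupling is LOW temperature for the link variables but the physical cell is CRITICAL-HARMONIC for orbits: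
read Wilson's torus measure at `β_k` as a specification on CELLS of side `b_k = t·M^{n_k}` lattice units
(`t` crux units), measure boundary data in the capped gauge-ORBIT transport weight
`w_c(U, U') = min(1, inf_g sup_{e ∈ c} d_r(U_e, (U'^g)_e)/α)` (`g` over gauge transformations at the
cell's interior sites), and ask for Dobrushin–Shlosman's finite-size condition in KANTOROVICH form at ONE
window shape `(2n₀+1)⁴` cells, eventually in `k`, with `k`-uniform `(n₀, γ₀ < 1)` — `stub_orbitKantorovichWindow`
(THE PHYSICS, open, hardest: marginal exactly at tree level, failed exactly by an `Ad`-invariant direction of `𝔤`).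
The engine `stub_krFiniteSizeDecay` (DS85 in the dual-Lipschitz = Dobrushin-1970/Föllmer form, on a finite 4-d
torus of cells, no translation invariance: "received" sum condition) turns the window condition into covariance
decay `C₀ (Σδ_f)(Σδ_g) e^{-κ D}` for cell-Lipschitz observables under ANY Gibbs measure of the cell specification,
with `(κ, C₀)` depending on `(n₀, γ₀, R)` only; run on the SYMMETRIC torus `(2S+1)⁴` itself (a finite site set)
it needs no transfer matrix and no thermal-trace control — `S`-uniformity is automatic (card (iv)).
`stub_wilsonTorusDLR` (Wilson's torus measure is a Gibbs measure of the torus Wilson specification) feeds it the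
crux's measure; `stub_smoothingToGap` (tower property `cov(A,B) = cov(γ_W A, γ_W B)` + frames adapted to the
supports + geometry) reaches the crux's `HasLatticeMassGap` for ALL bounded measurable species through the second,
`G`-blind physics clause `RoughCentreBound` (UV decoupling: the shell moves lattice-local links at the window
centre by `a_k²ε ≪ g_k`); `stub_transfer` is the transfer half (Disproof PROVER NOTE, weakened to "∃ rate").

Stubs (sorried, registered): `stub_krFiniteSizeDecay`, `stub_wilsonTorusDLR`, `stub_orbitKantorovichWindow`,
`stub_torusFrames`, `stub_specificationTower` (lead reshape 1), `stub_smoothingToGap`, `stub_transfer`. Composition (no hypotheses, concludes the crux BY NAME, sorry only inside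
the stubs it calls): `LatticeGapOnTrajectory_of`.

Disproof.lean (v3.7, RESISTS) used: §2 `concl_iff_split` — the two halves are produced at INDEPENDENT rates and
glued by `min` (`hasLatticeMassGap_anti`, `osData_hasMassGap_anti` re-proved below verbatim); §5 `WithoutSimple`
honoured AT `stub_orbitKantorovichWindow` (an `Ad G`-invariant direction of `𝔤`, e.g. the `u(1)` of `SU(2)×U(1)`,
transmits the constant-curvature boundary mode undiminished, `Σk ≥ |W|(1-o(1))`, so the window condition fails —
the line uses `IsCompactSimpleLieGroup` exactly there and in `stub_transfer`; the engine, DLR and smoothing stubs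
are `G`-blind and hold for photons); `WithoutBeta`/`WithoutTuning` enter the same stub (no `k`-uniform cell
exists without the tuning; at a finite-β first-order point two phases violate any DS condition); §1
`two_le_of_shape` (`2 ≤ M` is decoration — carried, unused); §6(i) no θ-uniform rate (here `Δ ≍ κ/t(θ)`,
`t(θ) ≍ e^{c/√θ}` on the UV branch); §6(ii) no observable-uniform constant (`C = C₀K_s²‖A‖‖B‖e^{…}`); PROVER
NOTE on the transfer half (thermal traces on odd tori) — the lattice half here never meets a thermal trace, the
transfer stub inherits the note's route and its caveat (line card §Transfer). Landed Negative lemmas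
(`Negative/ZeroCoupling*`, `Negative/BlowUp`): `β ≡ 0` has every gap and empties the tuning — consistent
(`stub_smoothingToGap` does not use `β_k → ∞`; only the physics stub does).
-/

set_option autoImplicit false

noncomputable section

namespace Summit.QuantumFields.YangMills.Cruxes.LatticeGapOnTrajectory.OrbitKantorovichFiniteSize

open scoped BigOperators Topology ENNReal ProbabilityTheory
open Filter MeasureTheory
open Literature.Probability.LatticeModels (Specification IsSpecification IsGibbsMeasure glueWith)
open Literature.MathematicalPhysics.QuantumFieldTheory
open Summit.QuantumFields.YangMills.Theses.ParabolicTrajectory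

/-! ## §1 Cells: a 4-d discrete torus of cell labels, cell-Lipschitz bounds, window kernels -/

section Cells

/-- **Coarse index** (cell labels): the discrete 4-torus `∏ᵢ ℤ/(μᵢ+1)` (one modulus per axis, so that
cells of different extents along different axes — asymmetric frames — are covered; `+1` keeps every factor
non-trivial so the type is finite). -/
abbrev CoarseIdx (μ : Fin 4 → ℕ) : Type := (i : Fin 4) → ZMod (μ i + 1)

/-- `ℓ^∞` distance on the coarse torus (per axis the cyclic distance `|valMinAbs (x - y)|`). -/
def cdist {μ : Fin 4 → ℕ} (x y : CoarseIdx μ) : ℕ :=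
  Finset.univ.sup fun i : Fin 4 => ((x i - y i).valMinAbs).natAbs

variable {ι V S : Type*}

/-- **Cell-Lipschitz bound** (the multi-site analogue of `DobrushinMetric.IsLipBound`, Föllmer 1988 Ch. I
(2.21)): `δ ≥ 0` and `|f σ - f τ| ≤ δ c · w c σ τ` whenever `σ, τ` agree off the cell `c`; `w c` is the
weight comparing two configurations of cell `c` (here: the capped orbit transport weight). -/
structure IsCellLipBound (cell : V → ι) (w : ι → (V → S) → (V → S) → ℝ) (f : (V → S) → ℝ)
    (δ : ι → ℝ) : Prop where
  nonneg : ∀ c, 0 ≤ δ c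
  le : ∀ (c : ι) (σ τ : V → S), (∀ v, cell v ≠ c → σ v = τ v) → |f σ - f τ| ≤ δ c * w c σ τ

variable [MeasurableSpace S]

/-- **Window averaging operator** `(γ_Λ f)(η) = ∫ f dγ_Λ(· | η)` (Föllmer's `π_V f`). -/
def windowAvg (γ : Specification V S) (Λ : Finset V) (f : (V → S) → ℝ) (η : V → S) : ℝ :=
  ∫ σ, f σ ∂(γ Λ η)

variable {μ : Fin 4 → ℕ} [Fintype V]

/-- The site set of the window of radius `n` (in cells) centred at the cell `c`. -/
def windowVol (cell : V → CoarseIdx μ) (n : ℕ) (c : CoarseIdx μ) : Finset V :=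
  Finset.univ.filter fun v => cdist c (cell v) ≤ n

/-- **Kantorovich–Rubinstein window package** = the hypotheses of the Dobrushin–Shlosman finite-size criterion in
DUAL-LIPSCHITZ (Vasserstein) form for a specification `γ` read on cells `cell : V → CoarseIdx μ`, weight `w`
bounded by `R`, window radius `n`, influence profile `k c y x ≥ 0` (window centre `c`, boundary cell `y`,
interior cell `x`):
* `w` is a bounded local weight (depends on the two configurations through cell `c` only);
* `range`: boundary cells beyond coarse distance `n+1` from the centre do not influence window-local expectations
  (finite range one cell);
* `contract` (DS85 condition `C_V`, Kantorovich form, stated dually on jointly cell-Lipschitz test functions —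
  triage r1-1 (a)/r1-2 (2): JOINT form, not marginal Lipschitz ratios): changing the boundary datum on ONE cell `y`
  outside the window moves the window-kernel expectation of a window-local `f` with cell-Lipschitz bounds `δ` by
  at most `(Σ_{x ∈ W} k c y x · δ x) · w y ω η`;
* `sum_le` (DS's `Σ_{∂V}Σ_V k ≤ γ₀|V|` in the RECEIVED form averaged over window positions, which is what the
  comparison iteration contracts in sup-norm without translation invariance and equals DS's per-window sum under
  translation covariance): for every cell `x`, `Σ_{c : x ∈ W_c} Σ_{y ∈ shell W_c} k c y x ≤ γ₀ · |{c : x ∈ W_c}|`. -/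
structure IsKRWindow (cell : V → CoarseIdx μ) (w : CoarseIdx μ → (V → S) → (V → S) → ℝ)
    (γ : Specification V S) (R : ℝ) (n : ℕ) (γ₀ : ℝ)
    (k : CoarseIdx μ → CoarseIdx μ → CoarseIdx μ → ℝ) : Prop where
  w_nonneg : ∀ c σ τ, 0 ≤ w c σ τ
  w_le : ∀ c σ τ, w c σ τ ≤ R
  w_local : ∀ (c : CoarseIdx μ) (σ σ' τ τ' : V → S), (∀ v, cell v = c → σ v = σ' v) →
    (∀ v, cell v = c → τ v = τ' v) → w c σ τ = w c σ' τ'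
  k_nonneg : ∀ c y x, 0 ≤ k c y x
  range : ∀ (c y : CoarseIdx μ), n + 1 < cdist c y → ∀ (ω η : V → S), (∀ v, cell v ≠ y → ω v = η v) →
    ∀ f : (V → S) → ℝ, Measurable f → (∃ B, ∀ σ, |f σ| ≤ B) →
      DependsOn f {v | cdist c (cell v) ≤ n} →
        windowAvg γ (windowVol cell n c) f ω = windowAvg γ (windowVol cell n c) f η
  contract : ∀ (c y : CoarseIdx μ), n < cdist c y → ∀ (ω η : V → S), (∀ v, cell v ≠ y → ω v = η v) →
    ∀ (f : (V → S) → ℝ) (δ : CoarseIdx μ → ℝ), Measurable f → (∃ B, ∀ σ, |f σ| ≤ B) →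
      DependsOn f {v | cdist c (cell v) ≤ n} → IsCellLipBound cell w f δ →
        |windowAvg γ (windowVol cell n c) f ω - windowAvg γ (windowVol cell n c) f η| ≤
          (∑ x ∈ Finset.univ.filter (fun x => cdist c x ≤ n), k c y x * δ x) * w y ω η
  sum_le : ∀ x : CoarseIdx μ,
    ∑ c ∈ Finset.univ.filter (fun c => cdist c x ≤ n),
        ∑ y ∈ Finset.univ.filter (fun y => cdist c y = n + 1), k c y x ≤
      γ₀ * (Finset.univ.filter (fun c => cdist c x ≤ n)).card

/-- **Window-averaging toolkit of a specification** (statement of `stub_specificationTower`; `G`-blind,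
provable now — the multi-site analogue of the tree's `DobrushinMetric.measurable_siteAvg`, `dependsOn_siteAvg`,
`integral_eq_of_isGibbsMeasure`): for a specification `γ` on a finite site set and a bounded measurable `f`,
the window average `γ_Λ f` is measurable, bounded by the same bound, depends only on the configuration off `Λ`
(outside-measurability), pulls out bounded measurable factors depending only on `Λᶜ` (properness), and has the
same expectation as `f` under every Gibbs measure (DLR for functions). This is exactly what the tower identity
`cov(A, B) = cov(γ_{W_A} A, γ_{W_B} B)` of `stub_smoothingToGap` consumes. -/
def SpecificationTower : Prop :=
  ∀ (V S : Type) [Fintype V] [MeasurableSpace S] (γ : Specification V S), IsSpecification γ →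
    ∀ (Λ : Finset V) (f : (V → S) → ℝ) (B : ℝ), Measurable f → (∀ σ, |f σ| ≤ B) →
      Measurable (windowAvg γ Λ f) ∧ (∀ η, |windowAvg γ Λ f η| ≤ B) ∧
      DependsOn (windowAvg γ Λ f) ((↑Λ : Set V)ᶜ) ∧
      (∀ h : (V → S) → ℝ, Measurable h → (∃ B', ∀ σ, |h σ| ≤ B') → DependsOn h ((↑Λ : Set V)ᶜ) →
        ∀ η, windowAvg γ Λ (fun σ => h σ * f σ) η = h η * windowAvg γ Λ f η) ∧
      ∀ ν : Measure (V → S), IsGibbsMeasure γ ν → ∫ η, windowAvg γ Λ f η ∂ν = ∫ σ, f σ ∂ν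

end Cells

/-- **The Dobrushin–Shlosman / Kantorovich finite-size ENGINE** (statement of `stub_krFiniteSizeDecay`): for window
radius `n`, ratio `γ₀ < 1` and weight bound `R` there are `κ > 0`, `C₀` (depending on NOTHING else) such that on
every coarse 4-torus with `≥ 2n+3` labels per axis (windows and their shells do not wrap), for every finite site
set, every specification satisfying the KR window package and EVERY Gibbs measure `ν` of it, covariances of bounded
measurable cell-local cell-Lipschitz observables decay like `C₀ (Σδ_f)(Σδ_g) e^{-κ D}` in the coarse distance `D`
between their cell supports (DobrushinShlosman1985 Thm (`C_V` ⇒ uniqueness + exponential decay; Vasserstein metric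
over a compact metric spin space); Dobrushin 1970 Thm 3–4 and Follmer1988 Ch. I (2.17)–(2.24) for the dual-Lipschitz
bookkeeping, in the tree as `DobrushinMetric.*`; Künsch CMP 84 (1982) / Georgii2011 §8.2 for the covariance step by
tilting, in the tree as `abs_covariance_le_of_isKRContraction`). -/
def KREngine : Prop :=
  ∀ (n : ℕ) (γ₀ R : ℝ), 0 ≤ γ₀ → γ₀ < 1 → 0 ≤ R → ∃ κ C₀ : ℝ, 0 < κ ∧ 0 ≤ C₀ ∧
    ∀ (μ : Fin 4 → ℕ) (V S : Type) [Fintype V] [MeasurableSpace S]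
      (cell : V → CoarseIdx μ) (w : CoarseIdx μ → (V → S) → (V → S) → ℝ)
      (γ : Specification V S) (k : CoarseIdx μ → CoarseIdx μ → CoarseIdx μ → ℝ),
      (∀ i, 2 * n + 3 ≤ μ i + 1) → IsSpecification γ → IsKRWindow cell w γ R n γ₀ k →
      ∀ ν : Measure (V → S), IsGibbsMeasure γ ν →
      ∀ (f g : (V → S) → ℝ) (Δf Δg : Finset (CoarseIdx μ)) (δf δg : CoarseIdx μ → ℝ) (D : ℕ),
        Measurable f → Measurable g → (∃ B, ∀ σ, |f σ| ≤ B) → (∃ B, ∀ σ, |g σ| ≤ B) →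
        DependsOn f {v | cell v ∈ Δf} → DependsOn g {v | cell v ∈ Δg} →
        IsCellLipBound cell w f δf → IsCellLipBound cell w g δg →
        (∀ x ∈ Δf, ∀ y ∈ Δg, D ≤ cdist x y) →
          |cov[f, g; ν]| ≤ C₀ * (∑ x ∈ Δf, δf x) * (∑ y ∈ Δg, δg y) * Real.exp (-(κ * D))

/-! ## §2 The torus gauge theory read on cells: frames, orbit weight, Wilson's torus specification -/

section Torus

variable {G : Type} [Group G] [TopologicalSpace G] [IsTopologicalGroup G] [CompactSpace G]
  [MeasurableSpace G] [BorelSpace G]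

/-- **Cyclic frame** of scale `b` on `ℤ/N`: a label map `q : ℤ/N → ℤ/m` that steps by `0` or `1` and whose fibres
are cyclic intervals of length in `[b, 2b]` (odd / prime torus sides force unequal cells — triage r1-1 (c): a
compact family of cell shapes, translation covariance lost, stated so). -/
def IsTorusFrame (N b : ℕ) {m : ℕ} (q : ZMod N → ZMod m) : Prop :=
  (∀ x : ZMod N, q (x + 1) = q x ∨ q (x + 1) = q x + 1) ∧
    ∀ c : ZMod m, ∃ (a : ZMod N) (ℓ : ℕ), b ≤ ℓ ∧ ℓ ≤ 2 * b ∧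
      ∀ x : ZMod N, q x = c ↔ ∃ j : ℕ, j < ℓ ∧ x = a + j

/-- **Torus frames exist and are coarse-Lipschitz** (statement of `stub_torusFrames`; pure `ZMod` combinatorics,
provable now). (1) For EVERY torus frame of scale `b ≥ 1` the cyclic site distance is controlled by the cyclic
label distance: `|y − x| ≤ 2b (|q y − q x| + 1)` (cells are at most `2b` long, both ways round). (2) Existence
with two prescribed short arcs: on `ℤ/N` with `(2n₀+3)·2b ≤ N`, `4w + 4 ≤ b`, for any two centres `x₁, x₂` there is
a frame of scale `b` with at least `2n₀+3` cells such that each of the arcs `xᵢ − w, …, xᵢ + w` lies inside ONE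
cell (the two arcs share a cell when they are close). Used by `stub_smoothingToGap` axis by axis (time axis: the
supports of `A` at time `0` and of `τ_m B` at time `m`; spatial axes: `x₁ = x₂ = 0`). -/
def TorusFramesExist : Prop :=
  (∀ (N b μ : ℕ) (q : ZMod N → ZMod (μ + 1)), NeZero N → 1 ≤ b → IsTorusFrame N b q →
      ∀ x y : ZMod N, ((y - x).valMinAbs).natAbs ≤ 2 * b * ((((q y - q x).valMinAbs).natAbs) + 1)) ∧
  ∀ (n₀ N b w : ℕ) (x₁ x₂ : ZMod N), NeZero N → 1 ≤ b → 4 * w + 4 ≤ b → (2 * n₀ + 3) * (2 * b) ≤ N →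
    ∃ (μ : ℕ) (q : ZMod N → ZMod (μ + 1)), 2 * n₀ + 3 ≤ μ + 1 ∧ IsTorusFrame N b q ∧
      (∀ j : ℕ, j ≤ 2 * w → q (x₁ - (w : ZMod N) + (j : ZMod N)) = q x₁) ∧
      (∀ j : ℕ, j ≤ 2 * w → q (x₂ - (w : ZMod N) + (j : ZMod N)) = q x₂)

variable {N : ℕ} {μ : Fin 4 → ℕ}

/-- Cell label of a torus site: apply the axis frames coordinatewise. -/
def siteCell (q : (i : Fin 4) → ZMod N → ZMod (μ i + 1)) (x : Site 4 N) : CoarseIdx μ :=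
  fun i => q i (x i)

/-- Cell label of a torus edge = label of its base point. -/
def cellOf (q : (i : Fin 4) → ZMod N → ZMod (μ i + 1)) (e : Edge 4 N) : CoarseIdx μ :=
  siteCell q e.1

/-- Interior site of the cell `c`: all eight incident edges (`(x, i)` and `(x - eᵢ, i)`) carry the label `c`.
Gauge transformations supported on interior sites of DISTINCT cells compose to one global gauge transformation,
and an interior site is never an endpoint of an edge of another cell. -/
def IsInteriorSite (q : (i : Fin 4) → ZMod N → ZMod (μ i + 1)) (c : CoarseIdx μ) (x : Site 4 N) : Prop :=
  siteCell q x = c ∧ ∀ i : Fin 4, siteCell q (x - Pi.single i 1) = c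

/-- Gauge transformations at the interior sites of the cell `c` (identity elsewhere). -/
def IsInteriorGauge (q : (i : Fin 4) → ZMod N → ZMod (μ i + 1)) (c : CoarseIdx μ) (g : Site 4 N → G) :
    Prop :=
  ∀ x : Site 4 N, ¬ IsInteriorSite q c x → g x = 1

/-- Entrywise deviation of two group elements in the faithful representation `r` (`≤ 2N²`; it induces the
topology of `G` since `r.ρ` is a closed embedding). -/
def repDist (r : LatticeRep G) (u v : G) : ℝ :=
  ∑ i, ∑ j, ‖r.ρ u i j - r.ρ v i j‖

/-- **Sup interior-orbit deviation** of two configurations on the cell `c`: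
`inf_{g interior gauge} sup_{e ∈ c} d_r(U_e, (U'^g)_e)`. -/
def cellDev (r : LatticeRep G) (q : (i : Fin 4) → ZMod N → ZMod (μ i + 1)) (c : CoarseIdx μ)
    (U U' : GaugeConfig 4 N G) : ℝ :=
  ⨅ g : {g : Site 4 N → G // IsInteriorGauge q c g},
    ⨆ e : {e : Edge 4 N // cellOf q e = c}, repDist r (U e.1) (gaugeTransform g.1 U' e.1)

/-- **The capped gauge-ORBIT transport weight at resolution `α`** (`cellOrbitWeight` of the idea card):
`w_c(U, U') = min(1, cellDev/α)` — bounded by `R = 1`, local in the cell, blind to interior gauge, so that every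
gauge-invariant cylinder observable is cellwise Lipschitz and `Σ_cells w` sees exactly the gauge-invariant content. -/
def orbitWeight (r : LatticeRep G) (α : ℝ) (q : (i : Fin 4) → ZMod N → ZMod (μ i + 1)) (c : CoarseIdx μ)
    (U U' : GaugeConfig 4 N G) : ℝ :=
  min 1 (cellDev r q c U U' / α)

/-- **Wilson's TORUS specification** at inverse coupling `β` on the symmetric torus `(ℤ/N)⁴` in the representation
`ρ` (the finite-volume, periodic analogue of the tree's `ymSpecification` on `ℤ⁴`): product Haar on the edges of
`Λ`, glued with the boundary condition `η` off `Λ`, tilted by `-β` times the FULL torus Wilson action (terms not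
touching `Λ` are constant in the glued variables and cancel in the normalisation). -/
def torusYM {Nr : ℕ} (ρ : G →* Matrix (Fin Nr) (Fin Nr) ℂ) (β : ℝ) (N : ℕ) [NeZero N] :
    Specification (Edge 4 N) G :=
  fun Λ η => ((Measure.pi fun _ : ↥Λ => haarProbability G).map (glueWith Λ · η)).tilted
    fun U => -β * wilsonAction ρ U

/-- **DLR description of the crux's measure** (statement of `stub_wilsonTorusDLR`): for every coupling and every
torus side, `torusYM` is a specification in Georgii's sense and the tree's `wilsonMeasure` (the measure inside
`latticeConnectedCorr`, hence inside `HasLatticeMassGap`) is a Gibbs measure for it. -/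
def WilsonTorusDLR (r : LatticeRep G) : Prop :=
  ∀ (β : ℝ) (N : ℕ) [NeZero N],
    IsSpecification (torusYM r.ρ β N) ∧
      IsGibbsMeasure (torusYM r.ρ β N) (wilsonMeasure (d := 4) (L := N) r.ρ β)

/-- **Rough-centre bound** (the second, `G`-blind physics clause — UV decoupling): on the torus of side `N` at
coupling `β`, read through the frames `q` at resolution `α` with window radius `n₀`, every bounded measurable
`f` depending on at most `s` edges of the CENTRAL cell `c` has a window average `γ_{W(c)} f` (a function of the
shell data) that is cell-Lipschitz in the ORBIT weight with bounds supported on the shell and total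
`Σ_shell δ ≤ K · ‖f‖_∞`. (Lattice-local supports only: for whole-cell rough statistics the TV influence tends to
`1` — the card's point (i) — whereas `s` links cannot resolve a physical-amplitude background response,
`a_k² ε ≪ g_k`; holds in the Coulomb phase too, carries no gap content.) -/
def RoughCentreBound (r : LatticeRep G) (β : ℝ) (N : ℕ) [NeZero N]
    (q : (i : Fin 4) → ZMod N → ZMod (μ i + 1)) (α : ℝ) (n₀ s : ℕ) (K : ℝ) : Prop :=
  ∀ (c : CoarseIdx μ) (f : GaugeConfig 4 N G → ℝ) (E : Finset (Edge 4 N)) (B : ℝ),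
    E.card ≤ s → (∀ e ∈ E, cellOf q e = c) → DependsOn f (↑E : Set (Edge 4 N)) → Measurable f →
    (∀ U, |f U| ≤ B) →
      ∃ δ : CoarseIdx μ → ℝ,
        IsCellLipBound (cellOf q) (orbitWeight r α q)
          (windowAvg (torusYM r.ρ β N) (windowVol (cellOf q) n₀ c) f) δ ∧
        (∀ y, cdist c y ≠ n₀ + 1 → δ y = 0) ∧
        ∑ y ∈ Finset.univ.filter (fun y => cdist c y = n₀ + 1), δ y ≤ K * B

/-- **Orbit–Kantorovich windows along the scheme** (statement of the physics stub, consumed by the smoothing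
stub): there are a cell scale `t ≥ 1` (crux units; `t(θ) ≍ e^{c/√θ}` on the UV branch, `O(1)` on the IR branch —
no `θ`-uniform rate, Disproof §6(i)), a window radius `n₀`, a ratio `γ₀ < 1`, a resolution `α > 0` and
rough-centre constants `K_s` such that for every support size `s`, eventually in `k`, on EVERY torus the crux's
clause visits (`S ≥ L_k`) and for EVERY family of axis frames of scale `b_k = t·M^{n_k}` with `≥ 2n₀+3` cells per
axis, Wilson's torus specification at `β_k` satisfies the KR window package in the orbit weight (`R = 1`) AND the
rough-centre bound with constant `K_s`. -/
def OrbitKRWindowsAlong (r : LatticeRep G) (M : ℕ) (sch : SpeciesScheme (YMSpecies G)) (n : ℕ → ℕ) : Prop :=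
  ∃ (t n₀ : ℕ) (γ₀ α : ℝ) (K : ℕ → ℝ), 1 ≤ t ∧ 0 ≤ γ₀ ∧ γ₀ < 1 ∧ 0 < α ∧
    ∀ s : ℕ, ∀ᶠ k in atTop, ∀ S : ℕ, sch.L k ≤ S →
      ∀ (μ : Fin 4 → ℕ) (q : (i : Fin 4) → ZMod (2 * S + 1) → ZMod (μ i + 1)),
        (∀ i, 2 * n₀ + 3 ≤ μ i + 1) → (∀ i, IsTorusFrame (2 * S + 1) (t * M ^ n k) (q i)) →
          (∃ kp : CoarseIdx μ → CoarseIdx μ → CoarseIdx μ → ℝ,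
              IsKRWindow (cellOf q) (orbitWeight r α q) (torusYM r.ρ (sch.β k) (2 * S + 1)) 1 n₀ γ₀ kp) ∧
          RoughCentreBound r (sch.β k) (2 * S + 1) q α n₀ s (K s)

/-- The transfer half of the crux's conclusion at rate `Δ` (verbatim the crux's last clause; = `Disproof.TransferHalf`). -/
def TransferHalf (r : LatticeRep G) (sch : SpeciesScheme (YMSpecies G)) (Δ : ℝ) : Prop :=
  ∀ sch' : SpeciesScheme (YMSpecies G), sch'.a = sch.a → sch'.β = sch.β → sch'.L = sch.L →
    ∀ T : OSData (YMSpecies G) 4, IsYangMillsFor r sch' T → T.HasMassGap Δ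

end Torus

/-! ## §3 The registered stubs -/

/-- **stub_krFiniteSizeDecay** — THE ENGINE (believed; size L; pure probability, `G`-blind). Dobrushin–Shlosman's
finite-size criterion in Kantorovich form, dual-Lipschitz bookkeeping: (1) WINDOW DUSTING (the multi-site analogue
of `DobrushinMetric.isLipBound_siteAvg`): by properness and locality of `w`, `γ_W f` of an `f` with cell-Lipschitz
bounds `δ` has bounds `δ'_y = δ_y + Σ_{x∈W} k c y x · δ_x` off `W` and `0` on `W`; (2) COMPARISON: for two states
`E₁, E₂` invariant under the window kernels avoiding a set `Δg` of cells, estimate vectors `a` (`|E₁f − E₂f| ≤ Σ a_x δ_x(f)`,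
start `a ≡ R` by interpolation) improve under the LAZY RANDOM WINDOW update `T = (1 − |W|/|ι|)·1 + |ι|⁻¹·K`,
`(Ka)_x = Σ_{c∋x}Σ_{y∈shell c} k c y x · a_y`, `‖K‖_∞ ≤ γ₀|W|` by `sum_le`, `K` moving mass `≤ 2n+1` cells per
application — so `T^m R ≤ R(1 − (1−γ₀)|W|/|ι|)^m` plus a binomial/Poisson tail in the number of `K`-steps needed to
cross the distance, both exponentially small in `D/(2n+1)` with `|ι|` cancelling; (3) COVARIANCE by tilting
`ν ↦ g̃ν/ν(g̃)`, `g̃ = g − g(τ₀) + RΣδ_g ≥ 0`, an invariant state off `Δg` (tree: `isInvariantState_tilt`,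
`abs_covariance_le_of_isKRContraction` is the one-site instance). `|{c : x ∈ W_c}| = (2n+1)⁴` by `2n+3 ≤ μᵢ+1`.
Why plausible: DS85's theorem with the coupling replaced by its dual (weaker hypothesis, same linear algebra);
Follmer1988 Remark (2.17): "the whole technique becomes more flexible … Vasserstein metric"; Weitz 2005 / Martinelli
1999 Thm 3.x for the window version with finite spins. Sources: DobrushinShlosman1985, Follmer1988 Ch. I §2,
Georgii2011 §8.2, Künsch CMP 84 (1982), DobrushinShlosman1987, MartinelliOlivieri1994. -/
theorem stub_krFiniteSizeDecay : KREngine := by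
  sorry

/-- **stub_wilsonTorusDLR** — Wilson's torus measure is DLR for Wilson's torus specification (provable now;
size M; finite-dimensional measure theory): `torusYM r.ρ β N` is a specification (probability: the tilting
density `exp(-β S)` is bounded, continuous, positive since `r.ρ` is continuous; outside-measurability and
a.e.-properness of the glued product Haar on the finite edge set, `G` being metrisable second countable through the
closed embedding `r.ρ`; consistency of tilted product measures), and `wilsonMeasure r.ρ β = Z⁻¹ e^{-βS} ∏ dHaar`
(a probability measure, `isProbabilityMeasure_wilsonMeasure`) satisfies `∫ γ_Λ(A|η) dμ(η) = μ(A)` (disintegration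
of product Haar along `Λ`/`Λᶜ` and the tilting identity). The torus analogue of the tree's
`isSpecification_ymSpecification_t2_holds` / `mem_ymGibbsMeasures_of_mem_infiniteVolumeLimitPoints`.
Sources: Georgii2011 Def. 1.23, Def. 2.9, Prop. 2.5; SeilerLNP1982 Ch. 2; arXiv:1803.01950 §2. -/
theorem stub_wilsonTorusDLR :
    ∀ (G : Type) [Group G] [TopologicalSpace G] [IsTopologicalGroup G] [CompactSpace G]
      [MeasurableSpace G] [BorelSpace G] (r : LatticeRep G), WilsonTorusDLR r := by
  sorry

/-- **stub_orbitKantorovichWindow** — THE PHYSICS (open; hardest; the line's bet; the only stub using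
`IsCompactSimpleLieGroup`, `β_k → ∞` and the tuning — Disproof §5 `WithoutSimple/WithoutBeta/WithoutTuning` are
honoured HERE). Along every M-adic tuned Wilson scheme there are `t, n₀, γ₀ < 1, α, K_s` with
`OrbitKRWindowsAlong`: (W) the orbit–Kantorovich window condition — at tree level the influence of the boundary cell
`y` on the interior cell `x` is the cell-scale harmonic measure, `Σ_yΣ_x k = |W|` EXACTLY for the massless Gaussian
(marginal: no false positive; an `Ad G`-invariant direction of `𝔤` transmits the constant-curvature mode and keeps
it `≥ |W|(1−o(1))` at every scale — photons, `SU(2)×U(1)`), while a mass `m` gives `Σ_yΣ_x k ≈ |∂W|(1+1/(mb)) ≤ γ₀|W|`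
once `b ≳ 1/m`, `2n₀+1 ≳ 8(1+1/(mb))/γ₀` (triage r1-1/r1-3 recomputation); the claim is that the interacting
theory at `b = t·D_k ≫ ξ_k` sits on the massive side, `k`-uniformly, for every frame of scale in `[b,2b]`
(the cell must exceed the confinement length: `t(θ) ≍ e^{c/√θ}` on the UV branch, Disproof §6(i)); large fields are
NOT assumed absent (triage r1-1 (b): `~e^{(10.8−c)β}` fixed-threshold large plaquettes per cell) — the sup over
boundary data includes rough data and the transport must SYNCHRONISE them; boundary-pinned defects are the
refuter's target (r1-2 retracted one attempt). (R) the rough-centre bound (UV decoupling, holds even for photons).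
Why it might be false: a weak-coupling massless phase for some compact simple `G` (the crux itself), or strong
mixing failing while the vacuum gap holds (Martinelli–Olivieri: boundary-pinned rigid defects — expected only for
FINITE gauge groups). Perturbatively invisible (Σk ≳ |W| to all orders). Sources: DobrushinShlosman1985,
Balaban1988Convergent, Balaban1989LargeFieldII, OsterwalderSeiler1978, Guth1980, arXiv:hep-lat/0204023 (complete
screening of a constant abelian chromomagnetic background at `T = 0`), Luscher1986, MartinelliOlivieri1994. -/
theorem stub_orbitKantorovichWindow :
    ∀ (G : Type) [Group G] [TopologicalSpace G] [IsTopologicalGroup G] [CompactSpace G]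
      [MeasurableSpace G] [BorelSpace G], IsCompactSimpleLieGroup G →
      ∀ (r : LatticeRep G) (M : ℕ) (θ : ℝ) (sch : SpeciesScheme (YMSpecies G)) (n : ℕ → ℕ),
        2 ≤ M → 0 < θ → (∀ k, sch.a k = ((M : ℝ) ^ n k)⁻¹) → Tendsto sch.β atTop atTop →
        Tendsto (fun k => ((M : ℝ) ^ n k) ^ 8 *
            latticeConnectedCorr r.ρ (sch.β k) (sch.side k) r.curvature.F r.curvature.F (M ^ n k))
          atTop (𝓝 θ) →
        OrbitKRWindowsAlong r M sch n := by
  sorry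

/-- **stub_torusFrames** — frames adapted to two short arcs exist on every long enough cycle, and every frame
is coarse-Lipschitz (provable now; size M; `ZMod.valMinAbs` bookkeeping). Split out of `stub_smoothingToGap` at the
lead's reshape 1 (2026-08-16) so that the deployment stub is geometry + assembly only. -/
theorem stub_torusFrames : TorusFramesExist := by
  sorry

/-- **stub_specificationTower** — the window-averaging toolkit (provable now; size M; templates
`DobrushinMetric.measurable_siteAvg` / `dependsOn_siteAvg` / `integral_eq_of_isGibbsMeasure`, Mathlib kernel
integrals via `IsSpecification.toKernel`). Split out of `stub_smoothingToGap` at reshape 1. -/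
theorem stub_specificationTower : SpecificationTower := by
  sorry

/-- **stub_smoothingToGap** — DEPLOYMENT ON THE SYMMETRIC TORUS (provable now; size M/L; `G`-blind, does not use
`β_k → ∞`; reshape 1: frames and the window toolkit are now the hypotheses `TorusFramesExist`, `SpecificationTower`).
Given the engine, the DLR description and the orbit–Kantorovich windows along the scheme, the crux's
lattice half holds with `Δ = κ(n₀, γ₀, 1)/(4t)`: fix species `A, B` (supports of `≤ s` edges, lattice diameter `w`);
eventually `b_k = t·M^{n_k} > 4w` and `(2S+1)/b_k ≥ 2(2n₀+3)` for all `S ≥ L_k` (`a_k L_k → ∞`,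
`SpeciesScheme.tendsto_L`), so for each `S` and each time separation `m ≤ S` axis frames of scale `b_k` exist with the
torus images of `supp A` and of `supp τ_m B` each inside ONE cell (`c_A`, `c_B`; cyclic interval partitions with
lengths in `[b, 2b]` and two prescribed phases). If `cdist c_A c_B ≤ 2n₀+2` (i.e. `a_k m ≤ 4t(n₀+2)`), the trivial
bound `2‖A‖‖B‖` is `≤ C e^{-Δ a_k m}` with `C = 2‖A‖‖B‖e^{4Δ t(n₀+2)}`. Otherwise TOWER: with
`Â = γ_{W(c_A)}(A∘lift)`, `B̂ = γ_{W(c_B)}(τ_mB∘lift)` (functions of the two shells, by `range` and outside-measurability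
of the kernels), DLR + properness give `cov(A∘lift, τ_mB∘lift) = cov(Â, B̂)` under `wilsonMeasure`;
`RoughCentreBound` gives shell-supported orbit-Lipschitz bounds with `Σδ ≤ K_s‖·‖_∞`; the ENGINE (specification
`torusYM`, Gibbs measure `wilsonMeasure` by DLR, `R = 1`) gives `|cov| ≤ C₀K_s²‖A‖‖B‖e^{-κD}` with
`D ≥ cdist c_A c_B − 2n₀ − 2 ≥ a_k m/(2t) − 2n₀ − 4` (cells have time-extent `≤ 2b_k`, `m ≤ S <` half the period),
i.e. the clause of `HasLatticeMassGap` with `k`-uniform `C`. Sources: Georgii2011 (DLR/properness, Rem. 1.24),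
Follmer1988 Ch. I (2.13), OsterwalderSeiler1978 §2, SeilerLNP1982 Ch. 2. -/
theorem stub_smoothingToGap :
    ∀ (G : Type) [Group G] [TopologicalSpace G] [IsTopologicalGroup G] [CompactSpace G]
      [MeasurableSpace G] [BorelSpace G] (r : LatticeRep G) (M : ℕ) (sch : SpeciesScheme (YMSpecies G))
      (n : ℕ → ℕ), 2 ≤ M → (∀ k, sch.a k = ((M : ℝ) ^ n k)⁻¹) →
      KREngine → TorusFramesExist → SpecificationTower → WilsonTorusDLR r → OrbitKRWindowsAlong r M sch n →
        ∃ Δ : ℝ, 0 < Δ ∧ HasLatticeMassGap r sch Δ := by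
  sorry

/-- **stub_transfer** — THE TRANSFER HALF (shared by every line of this crux; size L; the route of the Disproof's
PROVER NOTE, asked here in a WEAKER form: all crux hypotheses + the lattice half ⇒ SOME positive continuum rate).
For `T` with `IsYangMillsFor r sch' T` (`sch' = sch` up to species renormalisations) and time-ordered `F`, the
truncated diagonal function `Φ_F(t) = 𝔖(ΘF̄ ⊗ T_tF) − |𝔖(F)|²` is a positive Laplace transform `∫e^{-tλ}dν_F` (OS
reconstruction of `T`); `T.HasMassGap Δ'` iff `ν_F([0,Δ')) = 0` for all `F`, and polarisation. `Φ_F(t) = lim_k Φ^k_F(t/a_k)`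
along M-adic `t` (`ΘF̄ ⊗ T_tF` is off-diagonal). Lattice side: with Lüscher's positive transfer matrix for periodic
time of ANY length the torus truncated diagonal correlator of `Φ − ⟨Φ⟩` is a POSITIVE combination of exponentials
`Σ p_i|a_ij|²(μ_j/μ_i)^m`, hence log-convex on `[0, 2L_k+1]`; `Φ^k(0) → Φ(0)` bounds the left end, `HasLatticeMassGap`
termwise bounds the antipodal value `Φ^k(L_k)`, and log-convexity interpolates `Φ(t) ≤ Φ(0)^{1−t/t₁}(…)^{t/t₁}e^{-Δt}`.
CAVEAT (recorded, not hidden): the termwise constants of `HasLatticeMassGap` do not see the `a_k⁸` smallness of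
curvature-type covariances, so the antipodal bound carries the witness renormalisations `c_s(k)² ≲ Φ(0)/Var_latt`
and the interpolation closes only when the physical volume `ℓ_k = a_k L_k` outgrows `log(1/a_k)`; for slower volumes
the tuning lower bound `⟨P;τ_{D_k}P⟩ ≈ θ a_k⁸` (available here) or UV-renormalised clustering must be brought in —
if neither suffices the repair is route-level (scheme regularity or moving the clause into (A)), not this line's.
Sources: OsterwalderSeiler1978 §§2–3, Luscher1977 (CMP 54), GlimmJaffe1987 §6.1 and §19, Seiler1982 Ch. 2,
OsterwalderSchrader1975, JaffeWitten2000 §5. -/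
theorem stub_transfer :
    ∀ (G : Type) [Group G] [TopologicalSpace G] [IsTopologicalGroup G] [CompactSpace G]
      [MeasurableSpace G] [BorelSpace G], IsCompactSimpleLieGroup G →
      ∀ (r : LatticeRep G) (M : ℕ) (θ : ℝ) (sch : SpeciesScheme (YMSpecies G)) (n : ℕ → ℕ),
        2 ≤ M → 0 < θ → (∀ k, sch.a k = ((M : ℝ) ^ n k)⁻¹) → Tendsto sch.β atTop atTop →
        Tendsto (fun k => ((M : ℝ) ^ n k) ^ 8 *
            latticeConnectedCorr r.ρ (sch.β k) (sch.side k) r.curvature.F r.curvature.F (M ^ n k))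
          atTop (𝓝 θ) →
        ∀ Δ : ℝ, 0 < Δ → HasLatticeMassGap r sch Δ → ∃ Δ' : ℝ, 0 < Δ' ∧ TransferHalf r sch Δ' := by
  sorry

/-! ## §4 Gluing the two halves at independent rates (Disproof §2, re-proved verbatim) -/

section Anti

variable {G : Type} [Group G] [TopologicalSpace G] [IsTopologicalGroup G] [CompactSpace G]
  [MeasurableSpace G] [BorelSpace G] {ι : Type}

/-- The lattice half is antitone in the rate (Disproof §2 `hasLatticeMassGap_anti`). -/
theorem hasLatticeMassGap_anti (r : LatticeRep G) (sch : SpeciesScheme ι) {Δ Δ' : ℝ}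
    (hΔ' : Δ' ≤ Δ) (h : HasLatticeMassGap r sch Δ) : HasLatticeMassGap r sch Δ' := by
  intro A B
  obtain ⟨C, hC⟩ := h A B
  refine ⟨max C 0, hC.mono fun k hk S hS n hn => (hk S hS n hn).trans ?_⟩
  have hx : 0 ≤ sch.a k * n := mul_nonneg (sch.a_pos k).le (Nat.cast_nonneg n)
  calc C * Real.exp (-(Δ * (sch.a k * n)))
      ≤ max C 0 * Real.exp (-(Δ * (sch.a k * n))) :=
        mul_le_mul_of_nonneg_right (le_max_left _ _) (Real.exp_pos _).le
    _ ≤ max C 0 * Real.exp (-(Δ' * (sch.a k * n))) :=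
        mul_le_mul_of_nonneg_left (Real.exp_le_exp.2 (by nlinarith)) (le_max_right _ _)

/-- The OS mass gap is antitone in the rate (Disproof §2 `osData_hasMassGap_anti`). -/
theorem osData_hasMassGap_anti {d : ℕ} [NeZero d] (T : OSData ι d) {Δ Δ' : ℝ} (hΔ' : Δ' ≤ Δ)
    (h : T.HasMassGap Δ) : T.HasMassGap Δ' := by
  intro n m k k' F G' hF hG
  obtain ⟨C, hC⟩ := h n m k k' F G' hF hG
  refine ⟨max C 0, fun t ht H hH => (hC t ht H hH).trans ?_⟩
  calc C * Real.exp (-Δ * t) ≤ max C 0 * Real.exp (-Δ * t) :=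
        mul_le_mul_of_nonneg_right (le_max_left _ _) (Real.exp_pos _).le
    _ ≤ max C 0 * Real.exp (-Δ' * t) :=
        mul_le_mul_of_nonneg_left (Real.exp_le_exp.2 (by nlinarith)) (le_max_right _ _)

end Anti

/-! ## §5 The composition (kernel-checked; `sorry` only inside the five stubs it invokes) -/

/-- **The line closes the crux** (concludes `ParabolicTrajectory.LatticeGapOnTrajectory` BY NAME, no hypotheses).
Fix the crux's data and its Borel structure; the physics stub gives the orbit–Kantorovich windows along the scheme;
the smoothing stub, fed the engine and the DLR description, gives the lattice half at some `Δ₁ > 0`; the transfer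
stub gives the transfer half at some `Δ₂ > 0`; both halves are antitone, so `Δ = min Δ₁ Δ₂` (Disproof §2
`concl_iff_split`: halves at independent rates). -/
theorem LatticeGapOnTrajectory_of : LatticeGapOnTrajectory := by
  intro G _ _ _ _ hG r M θ sch n hM hθ hshape hβ htune
  letI : MeasurableSpace G := borel G
  haveI : BorelSpace G := ⟨rfl⟩
  have hW : OrbitKRWindowsAlong r M sch n :=
    stub_orbitKantorovichWindow G hG r M θ sch n hM hθ hshape hβ htune
  obtain ⟨Δ₁, hΔ₁, hlat⟩ :=
    stub_smoothingToGap G r M sch n hM hshape stub_krFiniteSizeDecay stub_torusFrames stub_specificationTower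
      (stub_wilsonTorusDLR G r) hW
  obtain ⟨Δ₂, hΔ₂, htr⟩ := stub_transfer G hG r M θ sch n hM hθ hshape hβ htune Δ₁ hΔ₁ hlat
  refine ⟨min Δ₁ Δ₂, lt_min hΔ₁ hΔ₂, hasLatticeMassGap_anti r sch (min_le_left _ _) hlat, ?_⟩
  intro sch' ha hb hL T hT
  exact osData_hasMassGap_anti T (min_le_right _ _) (htr sch' ha hb hL T hT)

end Summit.QuantumFields.YangMills.Cruxes.LatticeGapOnTrajectory.OrbitKantorovichFiniteSize

end
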